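import Summits.Ventures.PercRepro.Night2FatDegBasis

/-!
# night-2: FREE points of `W ∖ {x}` in the singly degenerate regime — the criteria

A point `f` of `W ∖ {x}` is FREE when `f ∉ clF M` and `f` lies on no class basis line coplanar with `M`
(`f ∈ clF {a, b}`, `a ≠ b` basis points, `rk ({a, b} ∪ {w₀, x}) ≤ 3` and `rk ({a, b} ∪ M) ≤ 3` never happen).
* **`card_filter_clF_le_rkN_of_indep`**: an independent set has at most `rk X` points in `clF X`;
* **`notMem_side_of_bad_pair`**: a basis line through a point of `W ∖ {x}` off `clF M` has no side basis point;
* **`no_two_class_lines_through_off`**: two class basis lines through a basis point off the spine cannot both exist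
  (that point would be the pencil point, which lies on the spine);
* **`free_of_spine_point`**: a spine point of `W ∖ {x}` off `clF M` is free when `≤ 1` basis point is on the spine and
  it is on no class basis line coplanar with `M` spanned by two basis points of `π₂` off the spine;
* **`free_of_plane_point`**: a point of `W ∖ {x}` in `π₂` off the spine is free when it is on no class basis line
  coplanar with `M` through two basis points of `π₂` (a spine–off pair or an off–off pair).
Paper `proofs/NIGHT-2-g35.md` §4.
-/

namespace PercRepro.Shadow

open PercRepro.ThmH PercRepro.PerFlat

variable {α : Type*} [DecidableEq α] {M : Matroid α} [M.Finite] {G : Finset α}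

/-- An independent set has at most `rk X` points in `clF X`. -/
theorem card_filter_clF_le_rkN_of_indep {P X : Finset α} (hP : M.Indep (P : Set α)) :
    (P.filter (fun e => e ∈ clF M X)).card ≤ rkN M X := by
  have hind : M.Indep ((P.filter (fun e => e ∈ clF M X) : Finset α) : Set α) :=
    hP.subset (by exact_mod_cast (Finset.filter_subset _ _))
  have h1 := rkN_eq_card_of_indep hind
  have h2 : rkN M (P.filter (fun e => e ∈ clF M X)) ≤ rkN M (clF M X) :=
    rkN_mono (fun e he => (Finset.mem_filter.1 he).2)
  rw [rkN_clF] at h2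
  omega

/-- **A basis line through a point of `W ∖ {x}` off `clF M` has no side basis point.** -/
theorem notMem_side_of_bad_pair (hs : ∀ e ∈ gr M, ∀ f ∈ gr M, e ≠ f → rkN M {e, f} = 2)
    {V : Finset α} (hVg : V ⊆ gr M) {R₁ : Finset α} (hR₁V : R₁ ⊆ V) {c₂ c₃ : α} (hc₂V : c₂ ∈ V) (hc₃V : c₃ ∈ V)
    (hc₂ : c₂ ∉ clF M R₁) (hc₃ : c₃ ∉ clF M (insert c₂ R₁))
    (hcover : ∀ e ∈ V, e ∈ clF M (insert c₂ R₁) ∨ e ∈ clF M (insert c₃ R₁))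
    {P W : Finset α} (hPV : P ⊆ V) (hWV : W ⊆ V) (hPW : ∀ e ∈ P, e ∉ W)
    {a b f : α} (ha : a ∈ P) (hb : b ∈ P) (hab : a ≠ b) (hf : f ∈ W) (hfab : f ∈ clF M ({a, b} : Finset α))
    (hfM : f ∉ clF M (V.filter (fun e => e ∈ clF M (insert c₃ R₁) ∧ e ∉ clF M R₁))) :
    ¬ (a ∈ clF M (insert c₃ R₁) ∧ a ∉ clF M R₁) ∧ ¬ (b ∈ clF M (insert c₃ R₁) ∧ b ∉ clF M R₁) := by
  constructor
  · rintro ⟨ha3, haL⟩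
    have := eq_of_mem_clF_pair_of_side hs hVg hR₁V hc₂V hc₃V hc₂ hc₃ hcover (hPV ha) (hPV hb) (hWV hf) ha3 haL
      hab hfab hfM
    exact hPW b hb (this ▸ hf)
  · rintro ⟨hb3, hbL⟩
    have hfba : f ∈ clF M ({b, a} : Finset α) := by rwa [Finset.pair_comm]
    have := eq_of_mem_clF_pair_of_side hs hVg hR₁V hc₂V hc₃V hc₂ hc₃ hcover (hPV hb) (hPV ha) (hWV hf) hb3 hbL
      hab.symm hfba hfM
    exact hPW a ha (this ▸ hf)

/-- **Two class basis lines through a basis point off the spine cannot both exist.** -/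
theorem no_two_class_lines_through_off (hs : ∀ e ∈ gr M, ∀ f ∈ gr M, e ≠ f → rkN M {e, f} = 2)
    {V : Finset α} (hVg : V ⊆ gr M) {w₀ x : α} (hw₀g : w₀ ∈ gr M) (hxg : x ∈ gr M) (hne : w₀ ≠ x)
    (hw₀V : w₀ ∉ clF M V) {R₁ : Finset α} (hR₁V : R₁ ⊆ V) (hR₁2 : rkN M R₁ = 2)
    (hcop : rkN M (insert w₀ (insert x R₁)) ≤ 3) {P : Finset α} (hPV : P ⊆ V) (hP : M.Indep (P : Set α))
    {c a b : α} (hc : c ∈ P) (ha : a ∈ P) (hb : b ∈ P) (hca : c ≠ a) (hcb : c ≠ b) (hab : a ≠ b)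
    (hcL : c ∉ clF M R₁) (hcls₁ : rkN M (insert w₀ (insert x {c, a})) ≤ 3)
    (hcls₂ : rkN M (insert w₀ (insert x {c, b})) ≤ 3) : False := by
  have hcg : c ∈ gr M := hVg (hPV hc)
  have hag : a ∈ gr M := hVg (hPV ha)
  have hbg : b ∈ gr M := hVg (hPV hb)
  have hR2 : rkN M ({c, a} : Finset α) = 2 := hs c hcg a hag hca
  have hR'2 : rkN M ({c, b} : Finset α) = 2 := hs c hcg b hbg hcb
  have hRV : ({c, a} : Finset α) ⊆ V := Finset.insert_subset (hPV hc) (Finset.singleton_subset_iff.2 (hPV ha))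
  have hR'V : ({c, b} : Finset α) ⊆ V := Finset.insert_subset (hPV hc) (Finset.singleton_subset_iff.2 (hPV hb))
  -- `{c, a, b}` is independent of rank `3`
  have hsub : ({c, a, b} : Finset α) ⊆ P :=
    Finset.insert_subset hc (Finset.insert_subset ha (Finset.singleton_subset_iff.2 hb))
  have hind : M.Indep (({c, a, b} : Finset α) : Set α) := hP.subset (by exact_mod_cast hsub)
  have h3 : rkN M ({c, a, b} : Finset α) = 3 := by
    rw [rkN_eq_card_of_indep hind, Finset.card_insert_of_notMem, Finset.card_pair hab]
    rw [Finset.mem_insert, Finset.mem_singleton, not_or]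
    exact ⟨hca, hcb⟩
  have hunion : ({c, a} : Finset α) ∪ {c, b} = {c, a, b} := by
    ext e
    simp only [Finset.mem_union, Finset.mem_insert, Finset.mem_singleton]
    tauto
  have hRR' : 3 ≤ rkN M (({c, a} : Finset α) ∪ {c, b}) := by rw [hunion, h3]
  have hpencil := pencil_point_of_class_lines hs hVg hw₀g hxg hne hw₀V hRV hR'V hR2 hR'2 hcls₁ hcls₂ hRR'
    (Finset.mem_insert_self _ _) (Finset.mem_insert_self _ _)
  have := mem_clF_of_class_of_pencil hVg hw₀g hxg hw₀V (hPV hc) hpencil hR₁V hR₁2 hcop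
  exact hcL this

/-- **A spine point of `W ∖ {x}` off `clF M` is free** when at most one basis point is on the spine and it is on
no class basis line coplanar with `M` through two basis points of `π₂` off the spine. -/
theorem free_of_spine_point (hs : ∀ e ∈ gr M, ∀ f ∈ gr M, e ≠ f → rkN M {e, f} = 2)
    {V : Finset α} (hVg : V ⊆ gr M) {R₁ : Finset α} (hR₁V : R₁ ⊆ V) (hR₁2 : rkN M R₁ = 2) {c₂ c₃ : α}
    (hc₂V : c₂ ∈ V) (hc₃V : c₃ ∈ V) (hc₂ : c₂ ∉ clF M R₁) (hc₃ : c₃ ∉ clF M (insert c₂ R₁))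
    (hcover : ∀ e ∈ V, e ∈ clF M (insert c₂ R₁) ∨ e ∈ clF M (insert c₃ R₁))
    {P W : Finset α} (hPV : P ⊆ V) (hWV : W ⊆ V) (hPW : ∀ e ∈ P, e ∉ W) {w₀ x : α}
    (hL₀ : ∀ a ∈ P, ∀ b ∈ P, a ≠ b → a ∈ clF M R₁ → b ∈ clF M R₁ → False)
    {s : α} (hsW : s ∈ W) (hsL : s ∈ clF M R₁)
    (hsM : s ∉ clF M (V.filter (fun e => e ∈ clF M (insert c₃ R₁) ∧ e ∉ clF M R₁)))
    (hcc : ∀ c ∈ P, ∀ c' ∈ P, c ≠ c' → c ∈ clF M (insert c₂ R₁) → c ∉ clF M R₁ → c' ∈ clF M (insert c₂ R₁) →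
      c' ∉ clF M R₁ → s ∈ clF M {c, c'} → rkN M (insert w₀ (insert x {c, c'})) ≤ 3 →
      4 ≤ rkN M ({c, c'} ∪ V.filter (fun e => e ∈ clF M (insert c₃ R₁) ∧ e ∉ clF M R₁))) :
    ∀ a ∈ P, ∀ b ∈ P, a ≠ b → s ∈ clF M {a, b} → rkN M (insert w₀ (insert x {a, b})) ≤ 3 →
      4 ≤ rkN M ({a, b} ∪ V.filter (fun e => e ∈ clF M (insert c₃ R₁) ∧ e ∉ clF M R₁)) := by
  intro a ha b hb hab hsab hcls
  have hR₁g : R₁ ⊆ gr M := hR₁V.trans hVg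
  obtain ⟨haM, hbM⟩ := notMem_side_of_bad_pair hs hVg hR₁V hc₂V hc₃V hc₂ hc₃ hcover hPV hWV hPW ha hb hab hsW
    hsab hsM
  -- a basis point of the pair on the spine forces the other into the spine
  have key : ∀ u v : α, u ∈ P → v ∈ P → u ≠ v → s ∈ clF M {u, v} → u ∈ clF M R₁ → v ∈ clF M R₁ := by
    intro u v hu hv huv hsuv huL
    have hug : u ∈ gr M := hVg (hPV hu)
    have hvg : v ∈ gr M := hVg (hPV hv)
    have hsg : s ∈ gr M := hVg (hWV hsW)
    have hsu : s ≠ u := by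
      rintro rfl
      exact hPW s hu hsW
    -- `clF {u, s} = clF R₁`
    have husg : ({u, s} : Finset α) ⊆ gr M := Finset.insert_subset hug (Finset.singleton_subset_iff.2 hsg)
    have hus2 : rkN M ({u, s} : Finset α) = 2 := hs u hug s hsg hsu.symm
    have hsubL : ({u, s} : Finset α) ⊆ clF M R₁ := by
      intro e he
      rw [Finset.mem_insert, Finset.mem_singleton] at he
      rcases he with rfl | rfl
      · exact huL
      · exact hsL
    have hcl : clF M ({u, s} : Finset α) = clF M R₁ :=
      clF_eq_clF_of_subset_clF_of_rkN_le hR₁g hsubL (by rw [hR₁2, hus2])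
    -- `v ∈ clF {u, s}`: the line `{u, v}` contains `s`, so `{u, v, s}` has rank `2` and `v ∈ clF {u, s}`
    have huvg : ({u, v} : Finset α) ⊆ gr M := Finset.insert_subset hug (Finset.singleton_subset_iff.2 hvg)
    have hv : v ∈ clF M ({u, s} : Finset α) := by
      have h1 : ({u, s} : Finset α) ⊆ clF M ({u, v} : Finset α) := by
        intro e he
        rw [Finset.mem_insert, Finset.mem_singleton] at he
        rcases he with rfl | rfl
        · exact subset_clF_of_subset_gr huvg (Finset.mem_insert_self _ _)
        · exact hsuv
      have hcl2 : clF M ({u, s} : Finset α) = clF M ({u, v} : Finset α) :=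
        clF_eq_clF_of_subset_clF_of_rkN_le huvg h1 (by rw [hus2, hs u hug v hvg huv])
      rw [hcl2]
      exact subset_clF_of_subset_gr huvg (Finset.mem_insert_of_mem (Finset.mem_singleton_self _))
    rw [hcl] at hv
    exact hv
  rcases spine_or_plane_or_side hcover (hPV ha) with haL | ⟨ha2, haL⟩ | haS
  · -- `a` on the spine: then `b` on the spine too, contradiction with `hL₀`
    exact absurd (key a b ha hb hab hsab haL) (fun hbL => hL₀ a ha b hb hab haL hbL)
  · rcases spine_or_plane_or_side hcover (hPV hb) with hbL | ⟨hb2, hbL⟩ | hbS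
    · have hsba : s ∈ clF M ({b, a} : Finset α) := by rwa [Finset.pair_comm]
      exact absurd (key b a hb ha hab.symm hsba hbL) (fun haL' => haL haL')
    · exact hcc a ha b hb hab ha2 haL hb2 hbL hsab hcls
    · exact absurd hbS hbM
  · exact absurd haS haM

/-- **A point of `W ∖ {x}` in `π₂` off the spine is free** when it is on no class basis line coplanar with `M`
through two basis points of `π₂`. -/
theorem free_of_plane_point (hs : ∀ e ∈ gr M, ∀ f ∈ gr M, e ≠ f → rkN M {e, f} = 2)
    {V : Finset α} (hVg : V ⊆ gr M) {R₁ : Finset α} (hR₁V : R₁ ⊆ V) (hR₁2 : rkN M R₁ = 2) {c₂ c₃ : α}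
    (hc₂V : c₂ ∈ V) (hc₃V : c₃ ∈ V) (hc₂ : c₂ ∉ clF M R₁) (hc₃ : c₃ ∉ clF M (insert c₂ R₁))
    (hcover : ∀ e ∈ V, e ∈ clF M (insert c₂ R₁) ∨ e ∈ clF M (insert c₃ R₁))
    {P W : Finset α} (hPV : P ⊆ V) (hWV : W ⊆ V) (hPW : ∀ e ∈ P, e ∉ W) {w₀ x : α}
    {f : α} (hfW : f ∈ W) (hf2 : f ∈ clF M (insert c₂ R₁)) (hfL : f ∉ clF M R₁)
    (hac : ∀ a ∈ P, ∀ c ∈ P, a ≠ c → a ∈ clF M R₁ → c ∈ clF M (insert c₂ R₁) → c ∉ clF M R₁ →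
      f ∈ clF M {a, c} → rkN M (insert w₀ (insert x {a, c})) ≤ 3 →
      4 ≤ rkN M ({a, c} ∪ V.filter (fun e => e ∈ clF M (insert c₃ R₁) ∧ e ∉ clF M R₁)))
    (hcc : ∀ c ∈ P, ∀ c' ∈ P, c ≠ c' → c ∈ clF M (insert c₂ R₁) → c ∉ clF M R₁ → c' ∈ clF M (insert c₂ R₁) →
      c' ∉ clF M R₁ → f ∈ clF M {c, c'} → rkN M (insert w₀ (insert x {c, c'})) ≤ 3 →
      4 ≤ rkN M ({c, c'} ∪ V.filter (fun e => e ∈ clF M (insert c₃ R₁) ∧ e ∉ clF M R₁))) :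
    f ∉ clF M (V.filter (fun e => e ∈ clF M (insert c₃ R₁) ∧ e ∉ clF M R₁)) ∧
    ∀ a ∈ P, ∀ b ∈ P, a ≠ b → f ∈ clF M {a, b} → rkN M (insert w₀ (insert x {a, b})) ≤ 3 →
      4 ≤ rkN M ({a, b} ∪ V.filter (fun e => e ∈ clF M (insert c₃ R₁) ∧ e ∉ clF M R₁)) := by
  have hR₁g : R₁ ⊆ gr M := hR₁V.trans hVg
  have hc₂g : c₂ ∈ gr M := hVg hc₂V
  have hc₃g : c₃ ∈ gr M := hVg hc₃V
  have hfM : f ∉ clF M (V.filter (fun e => e ∈ clF M (insert c₃ R₁) ∧ e ∉ clF M R₁)) :=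
    notMem_clF_side_of_plane_two hR₁g hc₂g hc₃g hc₂ hc₃ hf2 hfL
  refine ⟨hfM, ?_⟩
  intro a ha b hb hab hfab hcls
  obtain ⟨haM, hbM⟩ := notMem_side_of_bad_pair hs hVg hR₁V hc₂V hc₃V hc₂ hc₃ hcover hPV hWV hPW ha hb hab hfW
    hfab hfM
  -- both spine points would put `f` on the spine
  have hnotLL : ¬ (a ∈ clF M R₁ ∧ b ∈ clF M R₁) := by
    rintro ⟨haL, hbL⟩
    have habg : ({a, b} : Finset α) ⊆ gr M :=
      Finset.insert_subset (hVg (hPV ha)) (Finset.singleton_subset_iff.2 (hVg (hPV hb)))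
    have hsubL : ({a, b} : Finset α) ⊆ clF M R₁ := by
      intro e he
      rw [Finset.mem_insert, Finset.mem_singleton] at he
      rcases he with rfl | rfl
      · exact haL
      · exact hbL
    have hcl : clF M ({a, b} : Finset α) = clF M R₁ :=
      clF_eq_clF_of_subset_clF_of_rkN_le hR₁g hsubL (by rw [hR₁2, hs a (hVg (hPV ha)) b (hVg (hPV hb)) hab])
    rw [hcl] at hfab
    exact hfL hfab
  rcases spine_or_plane_or_side hcover (hPV ha) with haL | ⟨ha2, haL⟩ | haS
  · rcases spine_or_plane_or_side hcover (hPV hb) with hbL | ⟨hb2, hbL⟩ | hbS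
    · exact absurd ⟨haL, hbL⟩ hnotLL
    · exact hac a ha b hb hab haL hb2 hbL hfab hcls
    · exact absurd hbS hbM
  · rcases spine_or_plane_or_side hcover (hPV hb) with hbL | ⟨hb2, hbL⟩ | hbS
    · have hfba : f ∈ clF M ({b, a} : Finset α) := by rwa [Finset.pair_comm]
      have hcls' : rkN M (insert w₀ (insert x {b, a})) ≤ 3 := by rwa [Finset.pair_comm]
      have := hac b hb a ha hab.symm hbL ha2 haL hfba hcls'
      rwa [Finset.pair_comm]
    · exact hcc a ha b hb hab ha2 haL hb2 hbL hfab hcls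
    · exact absurd hbS hbM
  · exact absurd haS haM

end PercRepro.Shadow
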